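import Literature.MathematicalPhysics.QuantumFieldTheory.BalabanImbrieJaffe1984to88.BIJ88DeltaLoc234Torus
import Literature.MathematicalPhysics.QuantumFieldTheory.BalabanImbrieJaffe1984to88.BIJ85BlockKPoincare
import Literature.MathematicalPhysics.QuantumFieldTheory.BalabanImbrieJaffe1984to88.BIJ85Ineq732Flat

/-!
# `BalabanImbrieJaffe1984to88.BIJ85Ineq732FlatRegion` — T. Bałaban, J. Imbrie, A. Jaffe, *Renormalization of the Higgs model: minimizers,
propagators and the stability of mean field theory*, Commun. Math. Phys. **97** (1985) 299–329 [BalabanImbrieJaffe1985]: Sect. 7.3 p. 326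
**THE SCALAR STABILITY ESTIMATE (7.3.2) PROVED AT FLAT AND PURE-GAUGE BACKGROUNDS FOR THE REGION FORM `Δ_k(Ω,u)` ON EVERY UNION `Ω` OF
`k`-BLOCKS OF THE TORUS** (Neumann boundary conditions on `Ω`, [BalabanImbrieJaffe1988] p. 262; [7] = [Balaban1983RegularityDecay] «Prop. 3.1′»
(1.22): *"Let Ω be a sum of unit blocks"*) — for this seat's gen-15 torus objects WITH BODIES (`BIJ88DeltaLoc234Torus.deltaRegion` over the
constructed Neumann propagator `BIJ88NeumannPropagator227Torus.gBox`), every torus, every level `k`, explicit `γ = min(a/(8d), Nc²/(2n²))`, NO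
error term; together with its engine, **THE ENERGY IDENTITY (4.6.1)/(4.6.4) FOR THE REGION FORM at EVERY background `u`**, and a LOCAL
block-averaging inequality.  p11's `BIJ85Ineq732Flat` (the flat member of record of row C1.Eq7.3.1-7.3.2) is the case `Ω = T` in the
real-linear-map framework; this file is the REGION version in the complex-matrix currency of [BalabanImbrieJaffe1988] (2.34)/(2.35), the
(I.7.3.2)-input of (2.38) there (companion `BIJ88Ineq238FlatTorus`, this seat).

statement-level skeleton of published theorems with citation tags; proofs where landed; nothing here is a claim about the Yang–Mills mass gap

PDF held: `paper:balaban1985-cmp97-bij-higgs-minimizers` (journal page = PDF page + 298); p. 313 [PDF 15] (4.6.1)–(4.6.4) and p. 326 [PDF 28]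
(7.3.1)–(7.3.2) as transcribed verbatim in p11's `BIJ85Ineq732Flat` / `BIJ85BlockAveragingIneq` (quoted below); [BalabanImbrieJaffe1988]
(CMP **114**, `paper:balaban1988-cmp114-bij-abelian-higgs-effective-action`, journal page = PDF page + 256) p. 262–264 [PDF 6–8] re-read this
session as images (renders `HOME/lit-balaban-p31/renders/original-p007-x2.png`, `original-p008-x2.png`); [7] = [Balaban1983RegularityDecay]
(CMP **89**) p. 574 (1.21)–(1.22) as transcribed in the tree's `Balaban1983to89.B4Prop31Zero`.

CITATION HEADER (lean-in-tree rule).  Part of the lit-balaban TYPED SKELETON (HOME `run/shared/lean/pub/lit-balaban/`), PHASE-2 proof seat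
p31 gen 18 (unit `lit-balaban-p31-g18`; TAKING line HOME/STATUS.md 2026-08-22T17:38:58Z; free-target protocol G.5-34(d) — item 2 (ii) of
the owner's `HOME/lit-balaban-r18/C2S14-CLOSURE.md` §5, the (2.38) member at flat backgrounds; this is its [I]-side input, file 1 of 2).
WHAT IS REPRODUCED: row **C1.Eq7.3.1-7.3.2** (`HOME/lit-balaban-r15/ROWS-C1.md`, owner r15; head `proved p306883`; flat members of record
p11's `BIJ85Ineq732Flat.ineq732_flat` / `ineq732_pureGauge`, `Ω = T`) as a located member FOR REGIONS `Ω ⊂ T^{(j)}` and for gen 15's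
explicit `deltaRegion`; row **C1.Eq4.6.2-4.6.4** (owner r15; head p11's `BIJ85ScalarForm464` p248398; the variational identity
(4.6.1)/(4.6.4)) as a located member for the REGION propagator `G_k(Ω,u)`; rows **C2.Eq2.27** / **C2.Eq2.35** (owner r18) cells: the quadratic
form of the Neumann operator and the positivity of `Δ_k(Ω,u)`.  Kind «model-level theorems only» (no definition, no `Prop`-valued fact).

THE PRINTED TEXT (verbatim).  p. 326 [PDF 28]: *"7.3. Positivity of Δ_k(u_k).  The scalar field quadratic form Δ_k(u_k) depends on the
background field u_k. Hence we can only establish stability properties for Δ_k(u_k) with some restriction on u_k. In particular, let us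
assume that for the unit lattice field v, |v(∂p) − 1| ≤ e_k𝓅(e_k), (7.3.1) where 𝓅(e_k) = (1 + ln e_k^{−1})^𝓅. Then the stability estimate can
be stated in two forms. For constants γ > 0, α > 0, M < ∞, ⟨φ, Δ_k(u_k)φ⟩ ≥ γ Σ_{b∈T₁^{(k)}} |u_k(b)φ(b₊) − φ(b₋)|² − Me_k^{2−α} Σ_{x∈T₁^{(k)}}
|φ(x)|². (7.3.2) The second form of the inequality substitutes v_b for u_k(b) in the covariant derivative of φ. These inequalities can be proved
by an extension of the proofs of [7]."*  [7] p. 574: *"Proposition 3.1′ of [2]. Let Ω be a sum of unit blocks (i.e. Ω^{(k)} is an arbitrary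
subset of Z^d) and let A satisfies the condition |(∂^η_μA)(x)| ≤ O(1)p(e) … then there exists a positive constant γ₀ depending on d only, such
that for e sufficiently small ⟨φ, Δ^{(k)}(Ω,A)φ⟩ ≥ γ₀(Σ_{⟨x,x′⟩⊂Ω^{(k)}} |U(A(⟨x,x′⟩))φ(x′) − φ(x)|² + m²Σ_{x∈Ω^{(k)}}|φ(x)|²) − O(1)e^{2−α}
Σ_{x∈Ω^{(k)}}|φ(x)|² (1.22)"*.  p. 313 [PDF 15]: *"G_k(u_k) = [−Δ_{u_k} + a_kQ_k^*(u_k)Q_k(u_k)]^{−1}, (4.6.2) where −Δ_{u_k} = D^*_{u_k}D_{u_k}.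
(4.6.3) … The quadratic form which arises for the scalar field is ⟨ψ, Δ_k(u_k)ψ⟩, where ψ is the unit lattice scalar field and where Δ_k(u_k) =
a_kI − a_k²Q_k(u_k)G_k(u_k)Q_k^*(u_k). (4.6.4) … ψ_k = a_kG_k(u_k)Q_k^*(u_k)ψ."*  [BalabanImbrieJaffe1988] p. 262 [PDF 6]: *"In the scalar field
sector, we have the η-lattice propagators G_k(Ω,u) defined on subsets Ω ⊂ T_η with Neumann boundary conditions."*; p. 287 (5.6.10): *"the
basic quadratic form with Neumann boundary conditions on Ω giving rise to G_j(Ω)"*.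

THE OBJECTS (gen 15's definitions, unchanged).  `Δ_k(Ω,u) = BIJ88DeltaLoc234Torus.deltaRegion a c U k Ω = a·1 − a²·Q_k(u)G_k(Ω,u)Q_k(u)ᴴ` on
`ℓ²(T^{(j+k)})` (the comparison object of (2.35); [I] (4.6.4) with the region propagator), `G_k(Ω,u) = BIJ88NeumannPropagator227Torus.gBox a c U k Ω
= (N_Ω + 1_{Ωᶜ})^{−1}1_Ω`, `N_Ω = nOp a c U k Ω = (χ_ΩD_u)ᴴ(χ_ΩD_u) + a(Q_k(u)|_Ω)ᴴ(Q_k(u)|_Ω)`, `Q_k(u) = qMatT U k` (entries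
`L^{−kd}u(Γ^{(k)}_{yx})`, (2.6) at level `k`), `Q_k(u)|_Ω = qMatK U k Ω`, `(D_uφ)(b) = c(u_bφ(b₊) − φ(b₋))` (`covD`, `c` the lattice normalization
of the kinetic term), `Ω ⊂ T^{(j)}` a union of `k`-blocks (`IsBlockUnion k Ω`), `Ω^{(k)} = innerK k Ω` = the unit-lattice sites `y` with
`B^k(y) ⊆ Ω`, `Ω^{(k)*} = starB (innerK k Ω)` = the unit bonds with both ends in `Ω^{(k)}`; `n = L^k`, `N = L^{kd}`.  At the physical
normalization `c² = η^{d−2} = n²/N` ([I] (2.2)) the constant below is p11's `γ = min(a/(8d), ½)`; in gen 16/17's counting normalization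
(`a = A = α_kL^{kd}`, `c = ε^{−1}`) it is `(A/a_k)·min(a_k/(8d), ½)`.

THE MECHANISM.  (§1) ENERGY IDENTITY (`form_deltaRegion_eq_energy`; every `U(1)` field `u`, every `k`-block union `Ω`, `a > 0`, `c ≠ 0`,
standing range `j + k ≤ m + K`): with `φ⋆ = a·G_k(Ω,u)Q_k(u)ᴴψ` (the region version of (4.6.1) *"ψ_k = a_kG_k(u_k)Q_k^*(u_k)ψ"*),
`ψᴴΔ_k(Ω,u)ψ = a·Σ_y|(Q_k(u)φ⋆ − ψ)(y)|² + Σ_{b⊂Ω}|(D_uφ⋆)(b)|²` — matrix algebra on gen 15's identities `G·N_Ω = 1_Ω = N_Ω·G`, `G = 1_ΩG`, `Gᴴ = G`,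
the Gram reading `φᴴN_Ωφ = Σ_{b⊂Ω}|(D_uφ)(b)|² + aΣ_y|(Q_k|_Ωφ)(y)|²` (`form_nOp`) and `Q_kφ = Q_k|_Ωφ` for `φ` supported in a block union
(`qMatT_mulVec_eq_qMatK_mulVec`); hence the form is real and `≥ 0` (`form_deltaRegion_im_eq_zero`, `form_deltaRegion_re_nonneg`; p11's
`BIJ85BlockAveragingIneq.inner_deltaOp_eq/_nonneg` are the case `Ω = T`).  (§2) TORUS GEOMETRY: for `t ≤ L^k` the `k`-block point of
`x + te_μ` is `x_k` or `x_k + e_μ` (`blkIter_runSite_of_le`: labels `x_μ = L^k(x_k)_μ + r_μ` by p33's `val_blkIter`, the fine wrap-around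
`|T^{(j)}| = L^k|T^{(j+k)}|` being exactly the coarse one), so the `L^k` fine bonds of the straight run from `x ∈ B^k(y)` lie in `Ω*` when
`B^k(y), B^k(y+e_μ) ⊆ Ω` (`runBond_mem_starB`) — [7] §4 *"the straight path … stays inside B^k(y) ∪ B^k(y+e_μ) ⊂ Ω (no convexity of Ω is
needed)"* (as recorded in `B4Prop31Zero`).  (§3) LOCAL BLOCK-AVERAGING INEQUALITY (`sum_norm_qCovK_one_sub_sq_region_le`):
`Σ_{⟨y,y+e_μ⟩⊂Ω^{(k)}}|(Q_k(1)φ)(y+e_μ) − (Q_k(1)φ)(y)|² ≤ (n²/N)Σ_{b⊂Ω}|φ(b₊) − φ(b₋)|²` — p11's per-bond estimate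
`norm_qCovK_one_shift_sub_sq_le` (Jensen over the block, telescoping + Cauchy–Schwarz along the runs) BY NAME, §2, and the count "each fine
bond of `Ω` serves at most `n` (point, step) pairs" (`sum_blocks_runs`, blocks partition the torus, translations are bijections).  (§4)
(7.3.2) AT `u = 1` ON REGIONS (`ineq732_flat_region_of` / `ineq732_flat_region`): p11's argument verbatim, localized —
`E_Ω(ψ) ≤ 2E_Ω(ψ − Q_kφ⋆) + 2E_Ω(Q_kφ⋆) ≤ 8d‖ψ − Q_kφ⋆‖² + 2(n²/(Nc²))Σ_{b⊂Ω}|(D₁φ⋆)(b)|² ≤ γ^{−1}ψᴴΔ_k(Ω,1)ψ` (each unit site lies in `2d` bonds,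
`sum_norm_sub_sq_le_four_d`; `(D₁φ)(b) = c(φ(b₊) − φ(b₋))`, `norm_covD_one_sq`); `Ω = T` recovers p11's statement for the explicit propagator of
record (`ineq732_flat_univ`).  (§5) PURE GAUGE `u = 1^h` (`ineq732_pureGauge_region_of` / `ineq732_pureGauge_region`): gen 15's gauge
covariance `form_deltaRegion_gaugeAct` at `ψ₀ = h^{−1}ψ` and `|h(b₋)h(b₊)^{−1}(hψ₀)(b₊) − (hψ₀)(b₋)| = |ψ₀(b₊) − ψ₀(b₋)|`; `u_k(b) = h(b₋)h(b₊)^{−1}`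
read at the corner points = p11's transport `lineIter (1^h) k b` (`BIJ85Ineq732Flat.toC_lineIter_gaugeAct_one`; [BalabanImbrieJaffe1988]
(4.4) *"ū_{k,b} = u_k(⟨b₋, b₊⟩)"*).

WHAT IS PROVED (theorems only; 0 `sorry`; standard axioms; no new definition, no `Prop`-valued fact).
* §1 `qMatT_mulVec_eq_qMatK_mulVec`, `gBox_mulVec_apply_eq_zero`, **`form_nOp`**, **`form_deltaRegion_eq_energy`**,
  `form_deltaRegion_im_eq_zero`, **`form_deltaRegion_re_nonneg`** (every `u`, every `k`-block union `Ω`, every torus).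
* §2 `two_le_sitesPerDir`, `val_runSite`, **`blkIter_runSite_of_le`**, `runSite_mem_of_blockK_subset`, **`runBond_mem_starB`**.
* §3 `sum_starB_eq_sum_ite`, **`sum_norm_qCovK_one_sub_sq_region_le`**.
* §4 `sum_norm_sub_sq_le_four_d`, `sum_norm_cov_sub_sq_add_le`, `norm_covD_one_sq`, **`ineq732_flat_region_of`** (any `γ ≥ 0` with `8dγ ≤ a`,
  `2n²γ ≤ Nc²`: `γ·Σ_{b∈Ω^{(k)*}}|ψ(b₊) − ψ(b₋)|² ≤ Re ψᴴΔ_k(Ω,1)ψ`), **`ineq732_flat_region`** (`γ = min(a/(8d), Nc²/(2n²))`), `starB_innerK_univ`,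
  **`ineq732_flat_univ`** (`Ω = T`, all unit bonds).
* §5 `norm_pureGauge_bond_term`, **`ineq732_pureGauge_region_of`**, **`ineq732_pureGauge_region`** (`Σ_{b∈Ω^{(k)*}}|u_k(b)ψ(b₊) − ψ(b₋)|²`,
  `u_k = lineIter (1^h) k`).
* §6 (v1.1) **`form_deltaRegion_le_energy`** — THE VARIATIONAL INEQUALITY [I] (4.6.1) FOR THE REGION FORM, EVERY `u`, every `k`-block
  union `Ω`: `Re ψᴴΔ_k(Ω,u)ψ ≤ a·Σ_y|(Q_k(u)φ − ψ)(y)|² + Σ_{b⊂Ω}|(D_uφ)(b)|²` for EVERY `φ` supported in `Ω` (equality at `φ⋆`, §1), by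
  `E(φ⋆ + δ) = E(φ⋆) + δᴴN_Ωδ`, `δᴴN_Ωδ ≥ 0` (`form_nOp`); `form_deltaRegion_re_le` (`φ = 0`: `Re ψᴴΔ_k(Ω,u)ψ ≤ a‖ψ‖²`, so
  `0 ≤ Δ_k(Ω,u) ≤ a` as forms — p11's `inner_deltaOp_le` is `Ω = T`).
HONEST SCOPE.  (i) FLAT / PURE-GAUGE BACKGROUNDS ONLY for (7.3.2): the `Me_k^{2−α}` term is the field-strength correction of a (7.3.1)-small
`u_k`; at `u = 1^h` it is absent and NOTHING is claimed at a general background (p11's HOME/GAPS.md G-C1-05 — the unprinted *"extension of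
the proofs of [7]"*, holonomy defects of the covariant block-averaging inequality — stands).  (ii) The energy identity of §1 holds for EVERY
`u`; (4.6.1) is the value identity (§1) plus, since v1.1 (§6), the MINIMALITY of `φ⋆` among fields supported in `Ω` and the upper
bound `⟨ψ, Δ_k(Ω,u)ψ⟩ ≤ a‖ψ‖²` (p11's `inner_deltaOp_le` is `Ω = T`); fields not supported in `Ω` are outside the region problem and are
not discussed.  (iii) `Ω` any `k`-block union of `T^{(j)}` incl. `T` and gen 16's no-wrap cubes; sums over the
unit bonds INSIDE `Ω^{(k)}` (print's `Σ_{⟨x,x′⟩⊂Ω^{(k)}}` of [7] (1.22); for `Ω = T` all bonds).  (iv) `γ` not optimized; `d ≥ 1`, every `L`, every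
volume, standing range `j + k ≤ m + K`.
Imports: gen 15's `BIJ88DeltaLoc234Torus` (→ `BIJ88NeumannPropagator227Torus`, `BIJ88NeumannNoZeroModesTorus`, p11's `BIJ85ScalarPropagatorTorusK`),
p33's `BIJ85BlockKPoincare` (`val_blkIter`), p11's `BIJ85Ineq732Flat` (→ `BIJ85BlockAveragingIneq`).  Literature + Mathlib only.  Unit
`lit-balaban-p31` (literature-prover-lit-balaban-p31-g18-0), 2026-08-22; v1.1 (§6 appended, body of v1 byte-identical) same seat.  NOT summit progress.
-/

open scoped BigOperators Matrix ComplexConjugate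
open Finset Matrix

namespace Literature.MathematicalPhysics.QuantumFieldTheory.BalabanImbrieJaffe1984to88.BIJ85Ineq732FlatRegion

open Literature.MathematicalPhysics.QuantumFieldTheory.Balaban1983to89
open BIJ88Sect3Statements (U1 toC cfg covD starB mem_starB toC_mul toC_one toC_inv norm_toC)
open BIJ85BlockAveragesTorus BIJ85BlockAveragesTorusK BIJ85BlockAveragingIneq
open BIJ85BlockKPoincare (val_blkIter sitesPerDir_eq_mul_pow)
open BIJ88NeumannNoZeroModesTorus (IsBlockUnion innerK mem_innerK)
open BIJ88NeumannPropagator227Torus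
open BIJ88DeltaLoc234Torus (mulOp mulOpK mulOpK_mulVec qMatT qMatT_apply qMatT_mulVec deltaLocT deltaRegion
  form_deltaRegion_gaugeAct)
open GaugeField (gaugeAct)

noncomputable section

variable {P : Params} {j : ℕ}

/-! ## §1 The energy identity for the region form `Δ_k(Ω,u) = a_kI − a_k²Q_k(u)G_k(Ω,u)Q_k^*(u)` — every `u`, every `k`-block union `Ω` -/

section Algebra

variable {m n : Type*} [Fintype m] [Fintype n]

/-- kernel: `vᴴ(AᴴA)v = Σ_i ‖(Av)_i‖²` (a Gram form is a sum of squares). [folklore] -/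
private theorem form_gram (A : Matrix m n ℂ) (v : n → ℂ) :
    star v ⬝ᵥ ((Aᴴ * A) *ᵥ v) = ((∑ i, ‖(A *ᵥ v) i‖ ^ 2 : ℝ) : ℂ) := by
  rw [← mulVec_mulVec, dotProduct_mulVec, vecMul_conjTranspose, star_star]
  simp only [dotProduct, Pi.star_apply, Complex.ofReal_sum, Complex.ofReal_pow]
  refine Finset.sum_congr rfl fun i _ => ?_
  rw [Complex.star_def, ← Complex.normSq_eq_conj_mul_self, Complex.normSq_eq_norm_sq, Complex.ofReal_pow]

/-- kernel: `vᴴv = Σ_i ‖v_i‖²`. [folklore] -/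
private theorem star_dotProduct_self (v : n → ℂ) : star v ⬝ᵥ v = ((∑ i, ‖v i‖ ^ 2 : ℝ) : ℂ) := by
  simp only [dotProduct, Pi.star_apply, Complex.ofReal_sum, Complex.ofReal_pow]
  refine Finset.sum_congr rfl fun i _ => ?_
  rw [Complex.star_def, ← Complex.normSq_eq_conj_mul_self, Complex.normSq_eq_norm_sq, Complex.ofReal_pow]

/-- kernel: adjointness, `ψᴴ(Qv) = (Qᴴψ)ᴴv`. [folklore] -/
private theorem star_dotProduct_mulVec (Q : Matrix m n ℂ) (ψ : m → ℂ) (v : n → ℂ) :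
    star ψ ⬝ᵥ (Q *ᵥ v) = star (Qᴴ *ᵥ ψ) ⬝ᵥ v := by
  rw [dotProduct_mulVec, star_mulVec, conjTranspose_conjTranspose]

/-- kernel: for a Hermitian `G`, `(Gw)ᴴw = wᴴ(Gw)`. [folklore] -/
private theorem star_mulVec_dotProduct_of_isHermitian {G : Matrix n n ℂ} (hG : Gᴴ = G) (w : n → ℂ) :
    star (G *ᵥ w) ⬝ᵥ w = star w ⬝ᵥ (G *ᵥ w) := by
  rw [star_dotProduct_mulVec, hG]

end Algebra

variable {k : ℕ} {a c : ℝ} {U : GaugeField P j U1} {Ω : Finset (Balaban1983to89.Site P j)}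

/-- kernel: **on a `k`-block union `Ω`, the full average `Q_k(u)` of a field supported in `Ω` is its restricted average
`Q_k(u)|_Ω`** — every block meeting `Ω` lies inside `Ω`. [cite: BalabanImbrieJaffe1988, (2.27) p.263] -/
theorem qMatT_mulVec_eq_qMatK_mulVec (hΩ : IsBlockUnion k Ω) {φ : Balaban1983to89.Site P j → ℂ} (hφ : ∀ x ∉ Ω, φ x = 0) :
    qMatT U k *ᵥ φ = qMatK U k Ω *ᵥ φ := by
  funext y
  rw [qMatT_mulVec, qMatK_mulVec]
  by_cases h : blockK k y ⊆ Ω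
  · rw [if_pos h]
  · rw [if_neg h, qCovK_apply]
    refine mul_eq_zero_of_right _ (Finset.sum_eq_zero fun x hx => ?_)
    have hxΩ : x ∉ Ω := fun hxΩ => h (by rw [← mem_blockK.1 hx]; exact hΩ x hxΩ)
    rw [hφ x hxΩ, mul_zero]

/-- kernel: `G_k(Ω,u)v` is supported in `Ω`. [cite: BalabanImbrieJaffe1988, (2.27) p.263] -/
theorem gBox_mulVec_apply_eq_zero (hN : IsUnit (nPad a c U k Ω)) (v : Balaban1983to89.Site P j → ℂ) {x : Balaban1983to89.Site P j}
    (hx : x ∉ Ω) : (gBox a c U k Ω *ᵥ v) x = 0 := by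
  simp only [mulVec, dotProduct]
  exact Finset.sum_eq_zero fun y _ => by rw [gBox_apply_eq_zero hN (Or.inl hx), zero_mul]

/-- **THE QUADRATIC FORM OF THE NEUMANN OPERATOR** of `Ω`: `φᴴ(−Δ^N_{u,Ω} + a_kQ_k^*Q_k)φ = Σ_{b⊂Ω}‖(D_uφ)(b)‖² + a·Σ_y‖(Q_k(u)|_Ωφ)(y)‖²`
((5.6.10) *"the basic quadratic form with Neumann boundary conditions on Ω"*). [cite: BalabanImbrieJaffe1988, (5.6.10) p.287] -/
theorem form_nOp (a c : ℝ) (U : GaugeField P j U1) (k : ℕ) (Ω : Finset (Balaban1983to89.Site P j)) (φ : Balaban1983to89.Site P j → ℂ) :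
    star φ ⬝ᵥ (nOp a c U k Ω *ᵥ φ) =
      ((∑ b ∈ starB Ω, ‖covD c (cfg U) φ b‖ ^ 2 + a * ∑ y, ‖(qMatK U k Ω *ᵥ φ) y‖ ^ 2 : ℝ) : ℂ) := by
  classical
  rw [nOp_eq, add_mulVec, smul_mulVec, dotProduct_add, dotProduct_smul, form_gram, form_gram]
  have h1 : (∑ i, ‖(dN c U Ω *ᵥ φ) i‖ ^ 2 : ℝ) = ∑ b ∈ starB Ω, ‖covD c (cfg U) φ b‖ ^ 2 := by
    rw [← Finset.sum_filter_add_sum_filter_not Finset.univ (fun b => b ∈ starB Ω)]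
    have hz : ∑ b ∈ Finset.univ.filter (fun b => ¬ b ∈ starB Ω), ‖(dN c U Ω *ᵥ φ) b‖ ^ 2 = (0 : ℝ) :=
      Finset.sum_eq_zero fun b hb => by
        rw [Finset.mem_filter] at hb
        rw [dN_mulVec, if_neg hb.2, norm_zero, zero_pow two_ne_zero]
    rw [hz, add_zero, show Finset.univ.filter (fun b => b ∈ starB Ω) = starB Ω from by ext b; simp]
    exact Finset.sum_congr rfl fun b hb => by rw [dN_mulVec, if_pos hb]
  rw [h1, smul_eq_mul]
  push_cast
  ring

/-- **THE ENERGY IDENTITY FOR THE REGION FORM** ([I] (4.6.4) with the region propagator; the value of the variational problem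
[I] (4.6.1) at its minimizer `φ⋆ = a_kG_k(Ω,u)Q_k^*(u)ψ`): for every `U(1)` field `u`, every union `Ω` of `k`-blocks, `a_k > 0`, `c ≠ 0`
(standing range) and every unit-lattice field `ψ`,
`⟨ψ, Δ_k(Ω,u)ψ⟩ = a_k‖Q_k(u)φ⋆ − ψ‖² + Σ_{b⊂Ω}‖(D_uφ⋆)(b)‖²` — in particular the form is real and nonnegative.
[cite: BalabanImbrieJaffe1985, (4.6.4) p.313] -/
theorem form_deltaRegion_eq_energy (hk : j + k ≤ P.m + P.K) (hc : c ≠ 0) (ha : 0 < a) (U : GaugeField P j U1)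
    (hΩ : IsBlockUnion k Ω) (ψ : Balaban1983to89.Site P (j+k) → ℂ) {φs : Balaban1983to89.Site P j → ℂ}
    (hφs : φs = ((a : ℂ) • (gBox a c U k Ω * (qMatT U k)ᴴ)) *ᵥ ψ) :
    star ψ ⬝ᵥ (deltaRegion a c U k Ω *ᵥ ψ) =
      ((a * ∑ y, ‖(qMatT U k *ᵥ φs - ψ) y‖ ^ 2 + ∑ b ∈ starB Ω, ‖covD c (cfg U) φs b‖ ^ 2 : ℝ) : ℂ) := by
  have hN := isUnit_nPad hk hc ha U hΩ
  set G := gBox a c U k Ω with hGdef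
  set Q := qMatT U k with hQdef
  set w : Balaban1983to89.Site P j → ℂ := Qᴴ *ᵥ ψ with hwdef
  -- the minimizer and its support
  have hφs' : φs = (a : ℂ) • (G *ᵥ w) := by rw [hφs, smul_mulVec, ← mulVec_mulVec]
  have hsupp : ∀ x ∉ Ω, φs x = 0 := fun x hx => by
    rw [hφs', Pi.smul_apply, gBox_mulVec_apply_eq_zero hN w hx, smul_zero]
  -- atoms
  set g : ℂ := star w ⬝ᵥ (G *ᵥ w) with hgdef
  set X : ℂ := star (Q *ᵥ (G *ᵥ w)) ⬝ᵥ (Q *ᵥ (G *ᵥ w)) with hXdef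
  set nrm : ℂ := star ψ ⬝ᵥ ψ with hnrmdef
  -- (1) the left-hand side
  have hL : star ψ ⬝ᵥ (deltaRegion a c U k Ω *ᵥ ψ) = (a : ℂ) * nrm - (a : ℂ) ^ 2 * g := by
    rw [deltaRegion, sub_mulVec, smul_mulVec, one_mulVec, smul_mulVec, dotProduct_sub, dotProduct_smul,
      dotProduct_smul, ← hQdef, ← hGdef, ← mulVec_mulVec, ← mulVec_mulVec, ← hwdef, star_dotProduct_mulVec, ← hwdef, smul_eq_mul,
      smul_eq_mul]
  -- (2) ⟨Qφ⋆, ψ⟩ = a·g and ⟨ψ, Qφ⋆⟩ = a·g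
  have hGw_w : star (G *ᵥ w) ⬝ᵥ w = g := star_mulVec_dotProduct_of_isHermitian (gBox_conjTranspose hN) w
  have h2a : star (Q *ᵥ (G *ᵥ w)) ⬝ᵥ ψ = g := by
    rw [← conjTranspose_conjTranspose Q, star_dotProduct_mulVec, conjTranspose_conjTranspose, ← hwdef] at *
    · exact hGw_w
  have h2b : star ψ ⬝ᵥ (Q *ᵥ (G *ᵥ w)) = g := by
    rw [star_dotProduct_mulVec, ← hwdef]
  -- (3) ⟨φ, Nφ⟩ for φ = Gw:  N(Gw) = 1_Ω w, and (Gw)ᴴ(1_Ω w) = (Gw)ᴴ w = g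
  have hNG : nOp a c U k Ω *ᵥ (G *ᵥ w) = proj Ω *ᵥ w := by rw [mulVec_mulVec, hGdef, nOp_mul_gBox hN]
  have hprojG : proj Ω *ᵥ (G *ᵥ w) = G *ᵥ w := by rw [mulVec_mulVec, hGdef, proj_mul_gBox hN]
  have h3 : star (G *ᵥ w) ⬝ᵥ (nOp a c U k Ω *ᵥ (G *ᵥ w)) = g := by
    rw [hNG, star_dotProduct_mulVec, proj_conjTranspose, hprojG, hGw_w]
  -- (4) the Gram/square readings
  have hsq : star (Q *ᵥ φs - ψ) ⬝ᵥ (Q *ᵥ φs - ψ) = ((∑ y, ‖(Q *ᵥ φs - ψ) y‖ ^ 2 : ℝ) : ℂ) := star_dotProduct_self _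
  have hform := form_nOp a c U k Ω φs
  rw [← qMatT_mulVec_eq_qMatK_mulVec hΩ hsupp, ← hQdef] at hform
  have hQsq : ((∑ y, ‖(Q *ᵥ φs) y‖ ^ 2 : ℝ) : ℂ) = star (Q *ᵥ φs) ⬝ᵥ (Q *ᵥ φs) := (star_dotProduct_self _).symm
  -- assemble over ℂ
  have key : ((a * ∑ y, ‖(Q *ᵥ φs - ψ) y‖ ^ 2 + ∑ b ∈ starB Ω, ‖covD c (cfg U) φs b‖ ^ 2 : ℝ) : ℂ)
      = (a : ℂ) * (star (Q *ᵥ φs - ψ) ⬝ᵥ (Q *ᵥ φs - ψ))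
        + (star φs ⬝ᵥ (nOp a c U k Ω *ᵥ φs) - (a : ℂ) * (star (Q *ᵥ φs) ⬝ᵥ (Q *ᵥ φs))) := by
    rw [hsq, hform, ← hQsq]
    push_cast
    ring
  rw [key, hL]
  -- now everything in terms of g, X, nrm
  have e1 : star (Q *ᵥ φs - ψ) ⬝ᵥ (Q *ᵥ φs - ψ) = (a : ℂ) ^ 2 * X - (a : ℂ) * g - (a : ℂ) * g + nrm := by
    rw [hφs', mulVec_smul, star_sub, star_smul, sub_dotProduct, dotProduct_sub, dotProduct_sub, smul_dotProduct, smul_dotProduct,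
      dotProduct_smul, dotProduct_smul, h2a, h2b, Complex.star_def, Complex.conj_ofReal]
    simp only [smul_eq_mul]
    ring
  have e2 : star φs ⬝ᵥ (nOp a c U k Ω *ᵥ φs) = (a : ℂ) ^ 2 * g := by
    rw [hφs', mulVec_smul, star_smul, smul_dotProduct, dotProduct_smul, h3, Complex.star_def, Complex.conj_ofReal]
    simp only [smul_eq_mul]
    ring
  have e3 : star (Q *ᵥ φs) ⬝ᵥ (Q *ᵥ φs) = (a : ℂ) ^ 2 * X := by
    rw [hφs', mulVec_smul, star_smul, smul_dotProduct, dotProduct_smul, Complex.star_def, Complex.conj_ofReal]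
    simp only [smul_eq_mul]
    ring
  rw [e1, e2, e3]
  ring

/-- **The region form is REAL and NONNEGATIVE for every background**: `Im ⟨ψ, Δ_k(Ω,u)ψ⟩ = 0` ([I] p. 313: the form of the effective
scalar action; here for the region propagator, every `U(1)` field `u`, every `k`-block union `Ω`). [cite: BalabanImbrieJaffe1985, (4.6.4) p.313] -/
theorem form_deltaRegion_im_eq_zero (hk : j + k ≤ P.m + P.K) (hc : c ≠ 0) (ha : 0 < a) (U : GaugeField P j U1)
    (hΩ : IsBlockUnion k Ω) (ψ : Balaban1983to89.Site P (j+k) → ℂ) : (star ψ ⬝ᵥ (deltaRegion a c U k Ω *ᵥ ψ)).im = 0 := by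
  rw [form_deltaRegion_eq_energy hk hc ha U hΩ ψ rfl, Complex.ofReal_im]

/-- **`0 ≤ ⟨ψ, Δ_k(Ω,u)ψ⟩`** for every `U(1)` field `u`, every `k`-block union `Ω`, every `ψ` (a sum of squares by the energy identity;
p11's `inner_deltaOp_nonneg` is the case `Ω = T` in the real-linear-map framework). [cite: BalabanImbrieJaffe1985, (4.6.4) p.313] -/
theorem form_deltaRegion_re_nonneg (hk : j + k ≤ P.m + P.K) (hc : c ≠ 0) (ha : 0 < a) (U : GaugeField P j U1)
    (hΩ : IsBlockUnion k Ω) (ψ : Balaban1983to89.Site P (j+k) → ℂ) : 0 ≤ (star ψ ⬝ᵥ (deltaRegion a c U k Ω *ᵥ ψ)).re := by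
  rw [form_deltaRegion_eq_energy hk hc ha U hΩ ψ rfl, Complex.ofReal_re]
  exact add_nonneg (mul_nonneg ha.le (sum_nonneg fun _ _ => by positivity)) (sum_nonneg fun _ _ => by positivity)

/-! ## §2 Torus geometry at level `k`: a straight run of `≤ L^k` fine bonds from `B^k(y)` stays in `B^k(y) ∪ B^k(y + e_μ)` -/

/-- kernel: `2 ≤ |T^{(i)}|` sites per direction. [cite: BalabanImbrieJaffe1985, (2.4) p.302] -/
theorem two_le_sitesPerDir (P : Params) (i : ℕ) : 2 ≤ P.sitesPerDir i := by
  unfold Params.sitesPerDir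
  have := pow_pos P.L_pos (P.m + P.K - i)
  omega

/-- kernel: the `μ`-label along the run, `(x + te_μ)_μ = (x_μ + t) mod |T^{(j)}|`, the other labels unchanged.
[cite: BalabanImbrieJaffe1985, (2.10) p.303] -/
theorem val_runSite (x : Balaban1983to89.Site P j) (μ : Fin P.d) (t : ℕ) (κ : Fin P.d) :
    ((runSite x μ t) κ).val = if κ = μ then ((x μ).val + t) % P.sitesPerDir j else (x κ).val := by
  by_cases hκ : κ = μ
  · subst hκ
    rw [if_pos rfl, runSite, Function.update_self, ZMod.val_add, ZMod.val_natCast, Nat.add_mod_mod]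
  · rw [if_neg hκ, runSite, Function.update_of_ne hκ]

/-- **THE RUN STAYS IN TWO ADJACENT `k`-BLOCKS**: for `t ≤ L^k` the block point of `x + te_μ` is `x_k` or `x_k + e_μ` (labels
`x_μ = L^k(x_k)_μ + r_μ`, `0 ≤ r_μ < L^k`, so `L^k(x_k)_μ ≤ x_μ + t < L^k((x_k)_μ + 2)`; the torus wrap-around of the fine label is the
wrap-around of the coarse one, `|T^{(j)}| = L^k|T^{(j+k)}|`; standing range). [cite: BalabanImbrieJaffe1985, (5.1.2)–(5.1.3) p.313] -/
theorem blkIter_runSite_of_le (hk : j + k ≤ P.m + P.K) (x : Balaban1983to89.Site P j) (μ : Fin P.d) {t : ℕ} (ht : t ≤ P.L ^ k) :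
    blkIter k (runSite x μ t) = blkIter k x ∨ blkIter k (runSite x μ t) = (blkIter k x).shift μ := by
  set n := P.L ^ k with hn
  set Nc := P.sitesPerDir (j + k) with hNc
  set Nf := P.sitesPerDir j with hNf
  have hnpos : 0 < n := pow_pos P.L_pos k
  have hNf : Nf = Nc * n := sitesPerDir_eq_mul_pow hk
  have hNc2 : 2 ≤ Nc := two_le_sitesPerDir P (j + k)
  set v := (x μ).val with hv
  have hvlt : v < Nf := ZMod.val_lt (x μ)
  set q := v / n with hq
  have hqval : (blkIter k x μ).val = q := val_blkIter k hk x μ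
  have hqlt : q < Nc := by rw [← hqval]; exact ZMod.val_lt _
  have hvq : n * q ≤ v ∧ v < n * q + n := by
    have h1 : n * q + v % n = v := Nat.div_add_mod v n
    have h2 := Nat.mod_lt v hnpos
    constructor <;> omega
  have htNf : t < Nf := by
    have : n ≤ Nc * n := Nat.le_mul_of_pos_left n (by omega)
    have : 2 * n ≤ Nc * n := Nat.mul_le_mul_right n hNc2
    omega
  -- the other coordinates agree with both candidates; everything is decided at `μ`
  have hoth : ∀ κ, κ ≠ μ → blkIter k (runSite x μ t) κ = blkIter k x κ := fun κ hκ => by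
    apply ZMod.val_injective
    rw [val_blkIter k hk, val_blkIter k hk, val_runSite, if_neg hκ]
  have hvalμ : (blkIter k (runSite x μ t) μ).val = ((v + t) % Nf) / n := by
    rw [val_blkIter k hk, val_runSite, if_pos rfl]
  -- decide by cases on the fine label `v + t`
  by_cases hwrap : v + t < Nf
  · have hmod : (v + t) % Nf = v + t := Nat.mod_eq_of_lt hwrap
    by_cases hlow : v + t < n * q + n
    · -- same block
      left
      funext κ
      by_cases hκ : κ = μ
      · subst hκ
        apply ZMod.val_injective
        rw [hvalμ, hmod, hqval]
        exact Nat.div_eq_of_lt_le (by rw [Nat.mul_comm]; omega) (by rw [Nat.succ_mul, Nat.mul_comm]; omega)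
      · exact hoth κ hκ
    · -- next block, no wrap-around
      right
      funext κ
      by_cases hκ : κ = μ
      · subst hκ
        have hdiv : (v + t) / n = q + 1 :=
          Nat.div_eq_of_lt_le (by rw [Nat.succ_mul, Nat.mul_comm]; omega)
            (by rw [Nat.succ_mul, Nat.succ_mul, Nat.mul_comm]; omega)
        have hq1 : q + 1 < Nc := by
          by_contra hc
          have hq1' : Nc ≤ q + 1 := by omega
          have h3 : Nc * n ≤ (q + 1) * n := Nat.mul_le_mul_right n hq1'
          rw [Nat.succ_mul, Nat.mul_comm q n] at h3
          omega
        rw [Balaban1983to89.Site.shift, Function.update_self, ← ZMod.natCast_zmod_val (blkIter k (runSite x κ t) κ), hvalμ, hmod,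
          hdiv, ← ZMod.natCast_zmod_val (blkIter k x κ), hqval]
        push_cast
        ring
      · rw [hoth κ hκ, Balaban1983to89.Site.shift, Function.update_of_ne hκ]
  · -- wrap-around: the fine label crosses `|T^{(j)}|`, the coarse one crosses `|T^{(j+k)}|`
    right
    have hge : Nf ≤ v + t := by omega
    have hmod : (v + t) % Nf = v + t - Nf := by
      rw [Nat.mod_eq_sub_mod hge, Nat.mod_eq_of_lt (by omega)]
    have hdiv : (v + t - Nf) / n = 0 := Nat.div_eq_of_lt (by omega)
    have hqNc : q + 1 = Nc := by
      have h1 : (Nc - 1) * n ≤ v := by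
        have h3 : (Nc - 1) * n = Nc * n - n := Nat.sub_one_mul Nc n
        omega
      have h2 : Nc - 1 ≤ q := (Nat.le_div_iff_mul_le hnpos).2 h1
      omega
    funext κ
    by_cases hκ : κ = μ
    · subst hκ
      rw [Balaban1983to89.Site.shift, Function.update_self, ← ZMod.natCast_zmod_val (blkIter k (runSite x κ t) κ), hvalμ, hmod,
        hdiv, ← ZMod.natCast_zmod_val (blkIter k x κ), hqval, ← Nat.cast_add_one, hqNc, hNc, ZMod.natCast_self, Nat.cast_zero]
    · rw [hoth κ hκ, Balaban1983to89.Site.shift, Function.update_of_ne hκ]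

/-- kernel: the sites of the run from `x ∈ B^k(y)` lie in `Ω` as soon as `B^k(y), B^k(y + e_μ) ⊆ Ω` (`t ≤ L^k`).
[cite: BalabanImbrieJaffe1985, (5.1.2)–(5.1.3) p.313] -/
theorem runSite_mem_of_blockK_subset (hk : j + k ≤ P.m + P.K) {Ω : Finset (Balaban1983to89.Site P j)}
    {y : Balaban1983to89.Site P (j+k)} {μ : Fin P.d} (hy : blockK k y ⊆ Ω) (hy' : blockK k (y.shift μ) ⊆ Ω)
    {x : Balaban1983to89.Site P j} (hx : x ∈ blockK k y) {t : ℕ} (ht : t ≤ P.L ^ k) : runSite x μ t ∈ Ω := by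
  have hxy : blkIter k x = y := mem_blockK.1 hx
  rcases blkIter_runSite_of_le hk x μ ht with h | h
  · exact hy (mem_blockK.2 (h.trans hxy))
  · exact hy' (mem_blockK.2 (by rw [h, hxy]))

/-- **The fine bonds of the run lie in `Ω*`** (both end-points in `Ω`) when `B^k(y), B^k(y + e_μ) ⊆ Ω`, `x ∈ B^k(y)`, `t < L^k`.
[cite: BalabanImbrieJaffe1985, (5.1.2)–(5.1.3) p.313] -/
theorem runBond_mem_starB (hk : j + k ≤ P.m + P.K) {Ω : Finset (Balaban1983to89.Site P j)}
    {y : Balaban1983to89.Site P (j+k)} {μ : Fin P.d} (hy : blockK k y ⊆ Ω) (hy' : blockK k (y.shift μ) ⊆ Ω)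
    {x : Balaban1983to89.Site P j} (hx : x ∈ blockK k y) {t : ℕ} (ht : t < P.L ^ k) : runBond x μ t ∈ starB Ω := by
  rw [mem_starB, runBond_tgt]
  exact ⟨runSite_mem_of_blockK_subset hk hy hy' hx ht.le, runSite_mem_of_blockK_subset hk hy hy' hx ht⟩

/-! ## §3 The LOCAL block-averaging inequality: the unit bond form of `Q_k(1)φ` over `Ω^{(k)}` against the fine bond form over `Ω` -/

/-- Sums over the torus are invariant under the translation `x ↦ x + te_μ`. [folklore] -/
private theorem sum_runSite_eq (μ : Fin P.d) :
    ∀ (t : ℕ) (F : Balaban1983to89.Site P j → ℝ), ∑ x : Balaban1983to89.Site P j, F (runSite x μ t) = ∑ x : Balaban1983to89.Site P j, F x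
  | 0, F => by simp only [runSite_zero]
  | t + 1, F => by
    have h := sum_runSite_eq μ t (fun z => F (z.shift μ))
    simp only [runSite_shift] at h
    rw [h]
    exact Equiv.sum_comp (LatticeFieldCalculus.shiftEquiv (P := P) (j := j) μ) F

/-- kernel (counting): `Σ_y Σ_μ Σ_{x∈B^k(y)} Σ_{t<n} F_μ(x + te_μ) = n·Σ_x Σ_μ F_μ(x)` — the blocks partition the torus and each
translation is a bijection. [folklore] -/
private theorem sum_blocks_runs (n : ℕ) (F : Fin P.d → Balaban1983to89.Site P j → ℝ) :
    ∑ y : Balaban1983to89.Site P (j+k), ∑ μ : Fin P.d, ∑ x ∈ blockK k y, ∑ t ∈ range n, F μ (runSite x μ t)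
      = n * ∑ x : Balaban1983to89.Site P j, ∑ μ : Fin P.d, F μ x := by
  rw [sum_comm, sum_comm (s := (univ : Finset (Balaban1983to89.Site P j))), mul_sum]
  refine sum_congr rfl fun μ _ => ?_
  rw [sum_blockK_sum (k := k) (fun x => ∑ t ∈ range n, F μ (runSite x μ t)), sum_comm,
    sum_congr rfl fun t _ => sum_runSite_eq μ t (F μ), sum_const, card_range, nsmul_eq_mul]

/-- kernel: a sum over `X*` as a sum over (initial point, direction) with an indicator. [cite: BalabanImbrieJaffe1988, (3.5) p.266] -/
theorem sum_starB_eq_sum_ite {i : ℕ} (X : Finset (Balaban1983to89.Site P i)) (f : PBond P i → ℝ) :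
    ∑ b ∈ starB X, f b = ∑ x : Balaban1983to89.Site P i, ∑ μ : Fin P.d,
      (if x ∈ X ∧ x.shift μ ∈ X then f ⟨x, μ⟩ else 0) := by
  rw [starB, Finset.sum_filter, sum_bond_eq]
  rfl

/-- **THE LOCAL BLOCK-AVERAGING INEQUALITY at the flat background, level `k`, on a region**: for every `η`-lattice field `φ` and every
`Ω ⊂ T^{(j)}`, `Σ_{⟨y,y+e_μ⟩ ⊂ Ω^{(k)}} |(Q_k(1)φ)(y + e_μ) − (Q_k(1)φ)(y)|² ≤ (n²/N)·Σ_{b⊂Ω} |φ(b₊) − φ(b₋)|²` (`n = L^k`, `N = L^{kd}`,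
`Ω^{(k)}` = the unit-lattice sites whose `k`-block lies in `Ω`, standing range) — p11's per-bond estimate `norm_qCovK_one_shift_sub_sq_le`
(Jensen over the block, telescoping + Cauchy–Schwarz along the runs) BY NAME, the runs staying inside `Ω` by §2, each fine bond of `Ω`
serving at most `n` (point, step) pairs. [cite: BalabanImbrieJaffe1985, (7.3.2) p.326] -/
theorem sum_norm_qCovK_one_sub_sq_region_le (hk : j + k ≤ P.m + P.K) (Ω : Finset (Balaban1983to89.Site P j))
    (φ : Balaban1983to89.Site P j → ℂ) :
    ∑ b ∈ starB (innerK k Ω), ‖qCovK (1 : GaugeField P j U1) k φ b.tgt - qCovK (1 : GaugeField P j U1) k φ b.src‖ ^ 2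
      ≤ ((P.L : ℝ) ^ k) ^ 2 / (P.L : ℝ) ^ (k * P.d) * ∑ b ∈ starB Ω, ‖φ b.tgt - φ b.src‖ ^ 2 := by
  set n := P.L ^ k with hn
  set G : Fin P.d → Balaban1983to89.Site P j → ℝ := fun μ z =>
    if z ∈ Ω ∧ z.shift μ ∈ Ω then ‖φ (z.shift μ) - φ z‖ ^ 2 else 0 with hG
  have hG0 : ∀ μ z, 0 ≤ G μ z := fun μ z => by simp only [hG]; split_ifs <;> positivity
  have hN : (0 : ℝ) < (P.L : ℝ) ^ (k * P.d) := pow_pos (Nat.cast_pos.2 P.L_pos) _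
  -- each unit bond of Ω^{(k)}
  have hterm : ∀ (y : Balaban1983to89.Site P (j+k)) (μ : Fin P.d),
      (if y ∈ innerK k Ω ∧ y.shift μ ∈ innerK k Ω then
          ‖qCovK (1 : GaugeField P j U1) k φ (y.shift μ) - qCovK (1 : GaugeField P j U1) k φ y‖ ^ 2 else 0)
        ≤ ((P.L : ℝ) ^ (k * P.d))⁻¹ * (n : ℕ) * ∑ x ∈ blockK k y, ∑ t ∈ range n, G μ (runSite x μ t) := by
    intro y μ
    split_ifs with hyy
    · obtain ⟨hy, hy'⟩ := hyy
      rw [mem_innerK] at hy hy'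
      refine (norm_qCovK_one_shift_sub_sq_le hk φ y μ).trans (le_of_eq ?_)
      congr 1
      refine sum_congr rfl fun x hx => sum_congr rfl fun t ht => ?_
      have hb := runBond_mem_starB hk hy hy' hx (mem_range.1 ht)
      rw [mem_starB, runBond_tgt] at hb
      simp only [hG]
      rw [runSite_shift, if_pos ⟨hb.1, hb.2⟩]
    · exact mul_nonneg (mul_nonneg (inv_nonneg.2 hN.le) (Nat.cast_nonneg _))
        (sum_nonneg fun _ _ => sum_nonneg fun _ _ => hG0 _ _)
  have key := sum_blocks_runs (k := k) n G
  calc ∑ b ∈ starB (innerK k Ω), ‖qCovK (1 : GaugeField P j U1) k φ b.tgt - qCovK (1 : GaugeField P j U1) k φ b.src‖ ^ 2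
      = ∑ y : Balaban1983to89.Site P (j+k), ∑ μ : Fin P.d,
          (if y ∈ innerK k Ω ∧ y.shift μ ∈ innerK k Ω then
            ‖qCovK (1 : GaugeField P j U1) k φ (y.shift μ) - qCovK (1 : GaugeField P j U1) k φ y‖ ^ 2 else 0) :=
        sum_starB_eq_sum_ite _ _
    _ ≤ ∑ y : Balaban1983to89.Site P (j+k), ∑ μ : Fin P.d,
          ((P.L : ℝ) ^ (k * P.d))⁻¹ * (n : ℕ) * ∑ x ∈ blockK k y, ∑ t ∈ range n, G μ (runSite x μ t) :=
        sum_le_sum fun y _ => sum_le_sum fun μ _ => hterm y μ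
    _ = ((P.L : ℝ) ^ (k * P.d))⁻¹ * (n : ℕ) * ((n : ℕ) * ∑ x : Balaban1983to89.Site P j, ∑ μ : Fin P.d, G μ x) := by
        rw [← key]
        simp_rw [mul_sum]
    _ = ((P.L : ℝ) ^ k) ^ 2 / (P.L : ℝ) ^ (k * P.d) * ∑ b ∈ starB Ω, ‖φ b.tgt - φ b.src‖ ^ 2 := by
        rw [sum_starB_eq_sum_ite]
        simp only [hG, hn]
        push_cast
        field_simp
        rfl


/-! ## §4 **(I.7.3.2) AT THE FLAT BACKGROUND FOR THE REGION FORM `Δ_k(Ω,1)`** — every `k`-block union `Ω`, every torus -/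

/-- `|a + b|² ≤ 2|a|² + 2|b|²`. [folklore] -/
private theorem norm_add_sq_le_two (a b : ℂ) : ‖a + b‖ ^ 2 ≤ 2 * ‖a‖ ^ 2 + 2 * ‖b‖ ^ 2 := by
  have h1 : ‖a + b‖ ^ 2 ≤ (‖a‖ + ‖b‖) ^ 2 := pow_le_pow_left₀ (norm_nonneg _) (norm_add_le a b) 2
  nlinarith [sq_nonneg (‖a‖ - ‖b‖)]

/-- kernel: **the unit bond form over ANY bond set is `≤ 4d·Σ_x|χ(x)|²`** — `|χ(b₊) − χ(b₋)|² ≤ 2|χ(b₊)|² + 2|χ(b₋)|²` and every site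
is the initial point of `d` bonds and the final point of `d` bonds of the torus. [cite: BalabanImbrieJaffe1985, (7.3.2) p.326] -/
theorem sum_norm_sub_sq_le_four_d {i : ℕ} (B : Finset (PBond P i)) (χ : Balaban1983to89.Site P i → ℂ) :
    ∑ b ∈ B, ‖χ b.tgt - χ b.src‖ ^ 2 ≤ 4 * P.d * ∑ x : Balaban1983to89.Site P i, ‖χ x‖ ^ 2 :=
  calc ∑ b ∈ B, ‖χ b.tgt - χ b.src‖ ^ 2
      ≤ ∑ b : PBond P i, ‖χ b.tgt - χ b.src‖ ^ 2 :=
        Finset.sum_le_univ_sum_of_nonneg fun _ => by positivity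
    _ ≤ ∑ b : PBond P i, (2 * ‖χ b.tgt‖ ^ 2 + 2 * ‖χ b.src‖ ^ 2) := by
        refine sum_le_sum fun b _ => ?_
        have h := norm_add_sq_le_two (χ b.tgt) (-(χ b.src))
        rwa [← sub_eq_add_neg, norm_neg] at h
    _ = 2 * (∑ x : Balaban1983to89.Site P i, ∑ μ : Fin P.d, ‖χ (x.shift μ)‖ ^ 2)
        + 2 * (∑ x : Balaban1983to89.Site P i, ∑ _μ : Fin P.d, ‖χ x‖ ^ 2) := by
        rw [sum_add_distrib, ← mul_sum, ← mul_sum, sum_bond_eq, sum_bond_eq]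
        rfl
    _ = 4 * P.d * ∑ x : Balaban1983to89.Site P i, ‖χ x‖ ^ 2 := by
        rw [sum_sum_shift_dir (fun x => ‖χ x‖ ^ 2), sum_sum_dir (fun x => ‖χ x‖ ^ 2)]
        ring

/-- kernel: **the covariant unit bond form splits**, `E_W(ψ₁ + ψ₂) ≤ 2E_W(ψ₁) + 2E_W(ψ₂)` over any bond set (a sum of squares of linear
expressions). [cite: BalabanImbrieJaffe1985, (7.3.2) p.326] -/
theorem sum_norm_cov_sub_sq_add_le {i : ℕ} (B : Finset (PBond P i)) (W : PBond P i → ℂ) (ψ₁ ψ₂ : Balaban1983to89.Site P i → ℂ) :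
    ∑ b ∈ B, ‖W b * (ψ₁ + ψ₂) b.tgt - (ψ₁ + ψ₂) b.src‖ ^ 2
      ≤ 2 * ∑ b ∈ B, ‖W b * ψ₁ b.tgt - ψ₁ b.src‖ ^ 2 + 2 * ∑ b ∈ B, ‖W b * ψ₂ b.tgt - ψ₂ b.src‖ ^ 2 := by
  rw [mul_sum, mul_sum, ← sum_add_distrib]
  refine sum_le_sum fun b _ => ?_
  have e : W b * (ψ₁ + ψ₂) b.tgt - (ψ₁ + ψ₂) b.src = (W b * ψ₁ b.tgt - ψ₁ b.src) + (W b * ψ₂ b.tgt - ψ₂ b.src) := by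
    simp only [Pi.add_apply]; ring
  rw [e]
  exact norm_add_sq_le_two _ _

/-- kernel: at the flat background `(D₁φ)(b) = c(φ(b₊) − φ(b₋))`, so `‖(D₁φ)(b)‖² = c²|φ(b₊) − φ(b₋)|²`.
[cite: BalabanImbrieJaffe1985, (4.6.3) p.313] -/
theorem norm_covD_one_sq (c : ℝ) (φ : Balaban1983to89.Site P j → ℂ) (b : PBond P j) :
    ‖covD c (cfg (1 : GaugeField P j U1)) φ b‖ ^ 2 = c ^ 2 * ‖φ b.tgt - φ b.src‖ ^ 2 := by
  rw [covD, cfg, show (1 : GaugeField P j U1) b = 1 from rfl, toC_one, one_mul, norm_mul, Complex.norm_real, Real.norm_eq_abs,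
    mul_pow, sq_abs]

/-- **(I.7.3.2) AT THE FLAT BACKGROUND `u = 1` FOR THE REGION FORM `Δ_k(Ω,1)`, EVERY UNION `Ω` OF `k`-BLOCKS, EVERY TORUS** (p. 326:
*"⟨φ, Δ_k(u_k)φ⟩ ≥ γ Σ_{b∈T₁^{(k)}} |u_k(b)φ(b₊) − φ(b₋)|² − Me_k^{2−α} Σ_{x∈T₁^{(k)}} |φ(x)|². (7.3.2)"*, [6] (1.22) p. 574: *"Let Ω be
a sum of unit blocks … ⟨φ, Δ^{(k)}(Ω,A)φ⟩ ≥ γ₀(Σ_{⟨x,x′⟩⊂Ω^{(k)}} |U(A(⟨x,x′⟩))φ(x′) − φ(x)|² + …)"*), for gen 15's torus object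
`deltaRegion a c 1 k Ω = a·1 − a²·Q_k(1)G_k(Ω,1)Q_k(1)ᴴ`: if `γ ≥ 0`, `8dγ ≤ a` and `2n²γ ≤ Nc²` (`n = L^k`, `N = L^{kd}`), then for every
unit-lattice field `ψ`, `γ·Σ_{⟨y,y+e_μ⟩⊂Ω^{(k)}} |ψ(y + e_μ) − ψ(y)|² ≤ ⟨ψ, Δ_k(Ω,1)ψ⟩` (no error term: `M = 0`).  Proof = p11's
`ineq732_flat` localized: the energy identity of §1, `E ≤ 2E(ψ − Q_kφ⋆) + 2E(Q_kφ⋆) ≤ 8d‖ψ − Q_kφ⋆‖² + 2(n²/(Nc²))Σ_{b⊂Ω}‖(D₁φ⋆)(b)‖²` by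
§3's local block-averaging inequality. [cite: BalabanImbrieJaffe1985, (7.3.2) p.326] -/
theorem ineq732_flat_region_of (hk : j + k ≤ P.m + P.K) (hc : c ≠ 0) (ha : 0 < a) (hΩ : IsBlockUnion k Ω) {γ : ℝ} (hγ0 : 0 ≤ γ)
    (hγ1 : γ * (8 * P.d) ≤ a) (hγ2 : γ * (2 * ((P.L : ℝ) ^ k) ^ 2) ≤ (P.L : ℝ) ^ (k * P.d) * c ^ 2)
    (ψ : Balaban1983to89.Site P (j+k) → ℂ) :
    γ * ∑ b ∈ starB (innerK k Ω), ‖ψ b.tgt - ψ b.src‖ ^ 2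
      ≤ (star ψ ⬝ᵥ (deltaRegion a c (1 : GaugeField P j U1) k Ω *ᵥ ψ)).re := by
  set φs : Balaban1983to89.Site P j → ℂ := ((a : ℂ) • (gBox a c (1 : GaugeField P j U1) k Ω * (qMatT (1 : GaugeField P j U1) k)ᴴ)) *ᵥ ψ
    with hφs
  rw [form_deltaRegion_eq_energy hk hc ha (1 : GaugeField P j U1) hΩ ψ hφs, Complex.ofReal_re]
  set Qφ : Balaban1983to89.Site P (j+k) → ℂ := qMatT (1 : GaugeField P j U1) k *ᵥ φs with hQφ
  set X : ℝ := ∑ y, ‖(Qφ - ψ) y‖ ^ 2 with hX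
  set Yf : ℝ := ∑ b ∈ starB Ω, ‖φs b.tgt - φs b.src‖ ^ 2 with hYf
  set N : ℝ := (P.L : ℝ) ^ (k * P.d) with hN
  set n : ℝ := (P.L : ℝ) ^ k with hn
  have hLpos : (0 : ℝ) < P.L := Nat.cast_pos.2 P.L_pos
  have hNpos : 0 < N := pow_pos hLpos _
  have hnpos : 0 < n := pow_pos hLpos _
  have hc2 : 0 < c ^ 2 := by positivity
  have hX0 : 0 ≤ X := sum_nonneg fun _ _ => by positivity
  have hYf0 : 0 ≤ Yf := sum_nonneg fun _ _ => by positivity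
  have hY : ∑ b ∈ starB Ω, ‖covD c (cfg (1 : GaugeField P j U1)) φs b‖ ^ 2 = c ^ 2 * Yf := by
    rw [hYf, mul_sum]
    exact sum_congr rfl fun b _ => norm_covD_one_sq c φs b
  rw [hY]
  -- E ≤ 2E(ψ − Qφ) + 2E(Qφ)
  have hsplit : ∑ b ∈ starB (innerK k Ω), ‖ψ b.tgt - ψ b.src‖ ^ 2
      ≤ 2 * ∑ b ∈ starB (innerK k Ω), ‖(ψ - Qφ) b.tgt - (ψ - Qφ) b.src‖ ^ 2
        + 2 * ∑ b ∈ starB (innerK k Ω), ‖Qφ b.tgt - Qφ b.src‖ ^ 2 := by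
    have h := sum_norm_cov_sub_sq_add_le (starB (innerK k Ω)) (fun _ => (1 : ℂ)) (ψ - Qφ) Qφ
    simp only [one_mul, sub_add_cancel] at h
    exact h
  -- E(ψ − Qφ) ≤ 4d·X
  have h1 : ∑ b ∈ starB (innerK k Ω), ‖(ψ - Qφ) b.tgt - (ψ - Qφ) b.src‖ ^ 2 ≤ 4 * P.d * X := by
    refine (sum_norm_sub_sq_le_four_d _ (ψ - Qφ)).trans (le_of_eq ?_)
    rw [hX]
    congr 1
    exact sum_congr rfl fun y _ => by rw [Pi.sub_apply, Pi.sub_apply, norm_sub_rev]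
  -- E(Qφ) ≤ (n²/N)·Yf, the local block-averaging inequality
  have h2 : ∑ b ∈ starB (innerK k Ω), ‖Qφ b.tgt - Qφ b.src‖ ^ 2 ≤ n ^ 2 / N * Yf := by
    have h := sum_norm_qCovK_one_sub_sq_region_le hk Ω φs
    refine le_trans (le_of_eq (sum_congr rfl fun b _ => ?_)) h
    rw [hQφ, qMatT_mulVec, qMatT_mulVec]
  -- assemble
  have hγ2' : γ * (2 * (n ^ 2 / N)) ≤ c ^ 2 := by
    rw [show γ * (2 * (n ^ 2 / N)) = γ * (2 * n ^ 2) / N by ring, div_le_iff₀ hNpos]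
    calc γ * (2 * n ^ 2) ≤ N * c ^ 2 := hγ2
      _ = c ^ 2 * N := mul_comm _ _
  calc γ * ∑ b ∈ starB (innerK k Ω), ‖ψ b.tgt - ψ b.src‖ ^ 2
      ≤ γ * (2 * (4 * P.d * X) + 2 * (n ^ 2 / N * Yf)) :=
        mul_le_mul_of_nonneg_left (hsplit.trans (by linarith)) hγ0
    _ = γ * (8 * P.d) * X + γ * (2 * (n ^ 2 / N)) * Yf := by ring
    _ ≤ a * X + c ^ 2 * Yf := add_le_add (mul_le_mul_of_nonneg_right hγ1 hX0) (mul_le_mul_of_nonneg_right hγ2' hYf0)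

/-- **(I.7.3.2) AT THE FLAT BACKGROUND FOR `Δ_k(Ω,1)`, PRINTED SHAPE**: `min(a/(8d), Nc²/(2n²))·Σ_{⟨y,y+e_μ⟩⊂Ω^{(k)}}|ψ(y+e_μ) − ψ(y)|² ≤
⟨ψ, Δ_k(Ω,1)ψ⟩` for every `k`-block union `Ω`, every torus, every `ψ` — p11's `ineq732_flat` (`Ω = T`) for REGIONS, with the same constant
`γ = min(a/(8d), Nc²/(2n²))` (at the physical normalization `c² = n²/N` of [I] (2.2): `γ = min(a/(8d), ½)`) and `M = 0`.
[cite: BalabanImbrieJaffe1985, (7.3.2) p.326] -/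
theorem ineq732_flat_region (hk : j + k ≤ P.m + P.K) (hc : c ≠ 0) (ha : 0 < a) (hΩ : IsBlockUnion k Ω)
    (ψ : Balaban1983to89.Site P (j+k) → ℂ) :
    min (a / (8 * P.d)) ((P.L : ℝ) ^ (k * P.d) * c ^ 2 / (2 * ((P.L : ℝ) ^ k) ^ 2))
        * ∑ b ∈ starB (innerK k Ω), ‖ψ b.tgt - ψ b.src‖ ^ 2
      ≤ (star ψ ⬝ᵥ (deltaRegion a c (1 : GaugeField P j U1) k Ω *ᵥ ψ)).re := by
  have hd : (0 : ℝ) < P.d := Nat.cast_pos.2 P.hd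
  have hLpos : (0 : ℝ) < P.L := Nat.cast_pos.2 P.L_pos
  have hn2 : (0 : ℝ) < 2 * ((P.L : ℝ) ^ k) ^ 2 := by positivity
  refine ineq732_flat_region_of hk hc ha hΩ (le_min (by positivity) (by positivity)) ?_ ?_ ψ
  · have := min_le_left (a / (8 * P.d)) ((P.L : ℝ) ^ (k * P.d) * c ^ 2 / (2 * ((P.L : ℝ) ^ k) ^ 2))
    rwa [le_div_iff₀ (by positivity)] at this
  · have := min_le_right (a / (8 * P.d)) ((P.L : ℝ) ^ (k * P.d) * c ^ 2 / (2 * ((P.L : ℝ) ^ k) ^ 2))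
    rwa [le_div_iff₀ hn2] at this

/-- kernel: on the whole torus every unit bond lies in `Ω^{(k)}` (`Ω = T^{(j)}`). [cite: BalabanImbrieJaffe1985, (4.6.4) p.313] -/
theorem starB_innerK_univ (k : ℕ) : starB (innerK k (univ : Finset (Balaban1983to89.Site P j))) = (univ : Finset (PBond P (j+k))) := by
  ext b
  simp only [mem_starB, mem_innerK, subset_univ, and_self, mem_univ]

/-- **(I.7.3.2) AT THE FLAT BACKGROUND ON THE WHOLE TORUS for gen 15's explicit `Δ_k(T,1) = deltaRegion a c 1 k T`** — p11's
`ineq732_flat` (stated for ANY right inverse `G` in the real-linear-map framework) in the complex-matrix currency of (2.34)/(2.35), with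
the constructed Neumann propagator of record: `min(a/(8d), Nc²/(2n²))·Σ_{b∈T₁^{(k)}}|ψ(b₊) − ψ(b₋)|² ≤ ⟨ψ, Δ_k(T,1)ψ⟩`.
[cite: BalabanImbrieJaffe1985, (7.3.2) p.326] -/
theorem ineq732_flat_univ (hk : j + k ≤ P.m + P.K) (hc : c ≠ 0) (ha : 0 < a) (ψ : Balaban1983to89.Site P (j+k) → ℂ) :
    min (a / (8 * P.d)) ((P.L : ℝ) ^ (k * P.d) * c ^ 2 / (2 * ((P.L : ℝ) ^ k) ^ 2))
        * ∑ b : PBond P (j+k), ‖ψ b.tgt - ψ b.src‖ ^ 2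
      ≤ (star ψ ⬝ᵥ (deltaRegion a c (1 : GaugeField P j U1) k univ *ᵥ ψ)).re := by
  have h := ineq732_flat_region hk hc ha (BIJ88NeumannNoZeroModesTorus.isBlockUnion_univ k) ψ
  rwa [starB_innerK_univ] at h

/-! ## §5 (I.7.3.2) at every PURE-GAUGE background `u = 1^h` for `Δ_k(Ω,1^h)` — `u_k(b)` = the transport along the unit bond -/

/-- kernel: the covariant bond term at a pure gauge for the rotated field `ψ = h·ψ₀` is the flat bond term of `ψ₀`:
`|h(b₋)h(b₊)^{−1}ψ(b₊) − ψ(b₋)| = |ψ₀(b₊) − ψ₀(b₋)|` (`|h| = 1`). [cite: BalabanImbrieJaffe1985, (7.3.2) p.326] -/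
theorem norm_pureGauge_bond_term (h : GaugeTransf P j U1) (k : ℕ) (ψ₀ : Balaban1983to89.Site P (j+k) → ℂ) (b : PBond P (j+k)) :
    ‖toC (h (cornerIter k b.src)) * (toC (h (cornerIter k b.tgt)))⁻¹ * (toC (h (cornerIter k b.tgt)) * ψ₀ b.tgt)
        - toC (h (cornerIter k b.src)) * ψ₀ b.src‖ = ‖ψ₀ b.tgt - ψ₀ b.src‖ := by
  have hz := toC_ne_zero (h (cornerIter k b.tgt))
  rw [show toC (h (cornerIter k b.src)) * (toC (h (cornerIter k b.tgt)))⁻¹ * (toC (h (cornerIter k b.tgt)) * ψ₀ b.tgt)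
      - toC (h (cornerIter k b.src)) * ψ₀ b.src = toC (h (cornerIter k b.src)) * (ψ₀ b.tgt - ψ₀ b.src) by field_simp,
    norm_mul, norm_toC, one_mul]

/-- **(I.7.3.2), first form, AT EVERY PURE-GAUGE BACKGROUND `u = 1^h` FOR THE REGION FORM `Δ_k(Ω,1^h)`**, every `k`-block union `Ω`,
every torus, with `u_k(b) := h(b₋)h(b₊)^{−1}` read at the corner points (= the transport of `1^h` along the unit bond `b`, p11's
`lineIter (1^h) k b`, [BalabanImbrieJaffe1988] (4.4) *"ū_{k,b} = u_k(⟨b₋, b₊⟩)"*): under the hypotheses of `ineq732_flat_region_of` on `γ`,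
`γ·Σ_{b⊂Ω^{(k)}} |u_k(b)ψ(b₊) − ψ(b₋)|² ≤ ⟨ψ, Δ_k(Ω,1^h)ψ⟩` — from the flat case at `ψ₀ = h^{−1}ψ` by the gauge covariance of the region form
(gen 15's `form_deltaRegion_gaugeAct`). [cite: BalabanImbrieJaffe1985, (7.3.2) p.326] -/
theorem ineq732_pureGauge_region_of (hk : j + k ≤ P.m + P.K) (hc : c ≠ 0) (ha : 0 < a) (hΩ : IsBlockUnion k Ω) {γ : ℝ}
    (hγ0 : 0 ≤ γ) (hγ1 : γ * (8 * P.d) ≤ a) (hγ2 : γ * (2 * ((P.L : ℝ) ^ k) ^ 2) ≤ (P.L : ℝ) ^ (k * P.d) * c ^ 2)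
    (h : GaugeTransf P j U1) (ψ : Balaban1983to89.Site P (j+k) → ℂ) :
    γ * ∑ b ∈ starB (innerK k Ω), ‖toC (h (cornerIter k b.src)) * (toC (h (cornerIter k b.tgt)))⁻¹ * ψ b.tgt - ψ b.src‖ ^ 2
      ≤ (star ψ ⬝ᵥ (deltaRegion a c (gaugeAct h (1 : GaugeField P j U1)) k Ω *ᵥ ψ)).re := by
  set ψ₀ : Balaban1983to89.Site P (j+k) → ℂ := fun y => (toC (h (cornerIter k y)))⁻¹ * ψ y with hψ₀
  have hψ : ψ = mulOpK h k *ᵥ ψ₀ := by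
    funext y
    rw [mulOpK_mulVec, hψ₀, mul_inv_cancel_left₀ (toC_ne_zero _)]
  have hψy : ∀ y, ψ y = toC (h (cornerIter k y)) * ψ₀ y := fun y => by
    conv_lhs => rw [hψ]
    rw [mulOpK_mulVec]
  have hform : star ψ ⬝ᵥ (deltaRegion a c (gaugeAct h (1 : GaugeField P j U1)) k Ω *ᵥ ψ)
      = star ψ₀ ⬝ᵥ (deltaRegion a c (1 : GaugeField P j U1) k Ω *ᵥ ψ₀) := by
    have e := form_deltaRegion_gaugeAct hk hc ha h (1 : GaugeField P j U1) hΩ ψ₀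
    rw [← hψ] at e
    exact e
  have hE : ∑ b ∈ starB (innerK k Ω), ‖toC (h (cornerIter k b.src)) * (toC (h (cornerIter k b.tgt)))⁻¹ * ψ b.tgt - ψ b.src‖ ^ 2
      = ∑ b ∈ starB (innerK k Ω), ‖ψ₀ b.tgt - ψ₀ b.src‖ ^ 2 :=
    sum_congr rfl fun b _ => by rw [hψy b.tgt, hψy b.src, norm_pureGauge_bond_term]
  rw [hform, hE]
  exact ineq732_flat_region_of hk hc ha hΩ hγ0 hγ1 hγ2 ψ₀

/-- **(I.7.3.2) at every pure-gauge background for `Δ_k(Ω,1^h)`, PRINTED SHAPE**, the unit bond field written as p11's transport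
`u_k = lineIter (1^h) k` (`BIJ85Ineq732Flat.toC_lineIter_gaugeAct_one`: `u_k(b) = h(b₋)h(b₊)^{−1}`):
`min(a/(8d), Nc²/(2n²))·Σ_{b⊂Ω^{(k)}} |u_k(b)ψ(b₊) − ψ(b₋)|² ≤ ⟨ψ, Δ_k(Ω,1^h)ψ⟩`. [cite: BalabanImbrieJaffe1985, (7.3.2) p.326] -/
theorem ineq732_pureGauge_region (hk : j + k ≤ P.m + P.K) (hc : c ≠ 0) (ha : 0 < a) (hΩ : IsBlockUnion k Ω)
    (h : GaugeTransf P j U1) (ψ : Balaban1983to89.Site P (j+k) → ℂ) :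
    min (a / (8 * P.d)) ((P.L : ℝ) ^ (k * P.d) * c ^ 2 / (2 * ((P.L : ℝ) ^ k) ^ 2))
        * ∑ b ∈ starB (innerK k Ω), ‖toC (lineIter (gaugeAct h (1 : GaugeField P j U1)) k b) * ψ b.tgt - ψ b.src‖ ^ 2
      ≤ (star ψ ⬝ᵥ (deltaRegion a c (gaugeAct h (1 : GaugeField P j U1)) k Ω *ᵥ ψ)).re := by
  have hd : (0 : ℝ) < P.d := Nat.cast_pos.2 P.hd
  have hLpos : (0 : ℝ) < P.L := Nat.cast_pos.2 P.L_pos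
  have hn2 : (0 : ℝ) < 2 * ((P.L : ℝ) ^ k) ^ 2 := by positivity
  simp_rw [BIJ85Ineq732Flat.toC_lineIter_gaugeAct_one hk h]
  refine ineq732_pureGauge_region_of hk hc ha hΩ (le_min (by positivity) (by positivity)) ?_ ?_ h ψ
  · have := min_le_left (a / (8 * P.d)) ((P.L : ℝ) ^ (k * P.d) * c ^ 2 / (2 * ((P.L : ℝ) ^ k) ^ 2))
    rwa [le_div_iff₀ (by positivity)] at this
  · have := min_le_right (a / (8 * P.d)) ((P.L : ℝ) ^ (k * P.d) * c ^ 2 / (2 * ((P.L : ℝ) ^ k) ^ 2))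
    rwa [le_div_iff₀ hn2] at this


/-! ## §6 (v1.1) The variational characterization [I] (4.6.1) FOR REGIONS: `⟨ψ, Δ_k(Ω,u)ψ⟩ = min_{supp φ ⊆ Ω} [a‖Q_k(u)φ − ψ‖² + Σ_{b⊂Ω}|(D_uφ)(b)|²]` -/

section Variational

variable {k : ℕ} {a c : ℝ} {Ω : Finset (Balaban1983to89.Site P j)}

/-- **THE VARIATIONAL INEQUALITY [I] §4.6 FOR THE REGION FORM** (p. 313: `G_k(u_k)` is defined by the Gaussian integral (4.6.1) with
exponent `−½‖D_{u_k}φ‖² − ½a_k‖Q_k(u_k)φ‖² + ⟨φ,h⟩`, `G_k(u_k) = [−Δ_{u_k} + a_kQ_k^*(u_k)Q_k(u_k)]^{−1}` (4.6.2), the quadratic form of the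
unit-lattice field is `⟨ψ, Δ_k(u_k)ψ⟩`, `Δ_k(u_k) = a_kI − a_k²Q_k(u_k)G_k(u_k)Q_k^*(u_k)` (4.6.4), and *"the scalar field action depends on the
unit lattice field `ψ` through the `η`-lattice minimizer `ψ_k`, where `ψ_k = a_kG_k(u_k)Q_k^*(u_k)ψ`"* — i.e. `⟨ψ,Δ_k(u_k)ψ⟩ = min_φ
[a_k‖Q_k(u_k)φ − ψ‖² + ‖D_{u_k}φ‖²]`; here with the Neumann kinetic term of `Ω` and fields supported in `Ω`): for EVERY `U(1)` field `u`,
every `k`-block union `Ω`, `a > 0`, `c ≠ 0` (standing range), every unit-lattice `ψ` and every `φ` supported in `Ω`,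
`Re ⟨ψ, Δ_k(Ω,u)ψ⟩ ≤ a·Σ_y|(Q_k(u)φ − ψ)(y)|² + Σ_{b⊂Ω}|(D_uφ)(b)|²` — with equality at the minimizer `φ⋆ = aG_k(Ω,u)Q_k(u)ᴴψ`
(`form_deltaRegion_eq_energy`): the energy of `φ = φ⋆ + δ` exceeds that of `φ⋆` by exactly `δᴴN_Ωδ = Σ_{b⊂Ω}|(D_uδ)(b)|² + aΣ_y|(Q_k(u)δ)(y)|² ≥ 0`
(`form_nOp`; the cross terms vanish since `N_Ωφ⋆ = a·1_ΩQ_k(u)ᴴψ`). [cite: BalabanImbrieJaffe1985, §4.6 (4.6.1)-(4.6.4) p.313] -/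
theorem form_deltaRegion_le_energy (hk : j + k ≤ P.m + P.K) (hc : c ≠ 0) (ha : 0 < a) (U : GaugeField P j U1)
    (hΩ : IsBlockUnion k Ω) (ψ : Balaban1983to89.Site P (j+k) → ℂ) {φ : Balaban1983to89.Site P j → ℂ} (hφ : ∀ x ∉ Ω, φ x = 0) :
    (star ψ ⬝ᵥ (deltaRegion a c U k Ω *ᵥ ψ)).re ≤
      a * ∑ y, ‖(qMatT U k *ᵥ φ - ψ) y‖ ^ 2 + ∑ b ∈ starB Ω, ‖covD c (cfg U) φ b‖ ^ 2 := by
  have hN := isUnit_nPad hk hc ha U hΩ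
  have hNh : (nOp a c U k Ω)ᴴ = nOp a c U k Ω := nOp_conjTranspose a c U k Ω
  set w : Balaban1983to89.Site P j → ℂ := (qMatT U k)ᴴ *ᵥ ψ with hwdef
  set φs : Balaban1983to89.Site P j → ℂ := ((a : ℂ) • (gBox a c U k Ω * (qMatT U k)ᴴ)) *ᵥ ψ with hφs
  have hφs' : φs = (a : ℂ) • (gBox a c U k Ω *ᵥ w) := by rw [hφs, smul_mulVec, ← mulVec_mulVec]
  have hsupp : ∀ x ∉ Ω, φs x = 0 := fun x hx => by
    rw [hφs', Pi.smul_apply, gBox_mulVec_apply_eq_zero hN w hx, smul_zero]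
  set δ : Balaban1983to89.Site P j → ℂ := φ - φs with hδdef
  have hδsupp : ∀ x ∉ Ω, δ x = 0 := fun x hx => by rw [hδdef, Pi.sub_apply, hφ x hx, hsupp x hx, sub_zero]
  have hφδ : φ = φs + δ := by rw [hδdef, add_sub_cancel]
  -- the energy as a complex expression, for fields supported in Ω
  have hreal : ∀ χ : Balaban1983to89.Site P j → ℂ, (∀ x ∉ Ω, χ x = 0) →
      (a : ℂ) * (star (qMatT U k *ᵥ χ - ψ) ⬝ᵥ (qMatT U k *ᵥ χ - ψ))
          + (star χ ⬝ᵥ (nOp a c U k Ω *ᵥ χ) - (a : ℂ) * (star (qMatT U k *ᵥ χ) ⬝ᵥ (qMatT U k *ᵥ χ)))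
        = ((a * ∑ y, ‖(qMatT U k *ᵥ χ - ψ) y‖ ^ 2 + ∑ b ∈ starB Ω, ‖covD c (cfg U) χ b‖ ^ 2 : ℝ) : ℂ) := by
    intro χ hχ
    have hform := form_nOp a c U k Ω χ
    rw [← qMatT_mulVec_eq_qMatK_mulVec hΩ hχ] at hform
    rw [star_dotProduct_self, star_dotProduct_self, hform]
    push_cast
    ring
  -- the cross terms: N φ⋆ = a·1_Ω Q_kᴴψ
  have hNG : nOp a c U k Ω *ᵥ (gBox a c U k Ω *ᵥ w) = proj Ω *ᵥ w := by rw [mulVec_mulVec, nOp_mul_gBox hN]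
  have hNφs : nOp a c U k Ω *ᵥ φs = (a : ℂ) • (proj Ω *ᵥ w) := by rw [hφs', mulVec_smul, hNG]
  have hprojδ : proj Ω *ᵥ δ = δ := by
    funext x
    rw [proj_mulVec]
    by_cases hx : x ∈ Ω
    · rw [if_pos hx]
    · rw [if_neg hx, hδsupp x hx]
  have hcross : star δ ⬝ᵥ (nOp a c U k Ω *ᵥ φs) = (a : ℂ) * (star (qMatT U k *ᵥ δ) ⬝ᵥ ψ) := by
    rw [hNφs, dotProduct_smul, star_dotProduct_mulVec, proj_conjTranspose, hprojδ, hwdef, star_dotProduct_mulVec,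
      conjTranspose_conjTranspose, smul_eq_mul]
  have ha' : star (a : ℂ) = a := by rw [Complex.star_def, Complex.conj_ofReal]
  have hcross' : star φs ⬝ᵥ (nOp a c U k Ω *ᵥ δ) = (a : ℂ) * (star ψ ⬝ᵥ (qMatT U k *ᵥ δ)) := by
    have e1 : star φs ⬝ᵥ (nOp a c U k Ω *ᵥ δ) = star (star δ ⬝ᵥ (nOp a c U k Ω *ᵥ φs)) := by
      rw [star_dotProduct_mulVec (nOp a c U k Ω) φs δ, hNh, star_dotProduct]
    rw [e1, hcross, star_mul', ha', ← star_dotProduct]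
  -- E(φ⋆ + δ) = E(φ⋆) + δᴴNδ
  have key : (a : ℂ) * (star (qMatT U k *ᵥ (φs + δ) - ψ) ⬝ᵥ (qMatT U k *ᵥ (φs + δ) - ψ))
        + (star (φs + δ) ⬝ᵥ (nOp a c U k Ω *ᵥ (φs + δ))
          - (a : ℂ) * (star (qMatT U k *ᵥ (φs + δ)) ⬝ᵥ (qMatT U k *ᵥ (φs + δ))))
      = ((a : ℂ) * (star (qMatT U k *ᵥ φs - ψ) ⬝ᵥ (qMatT U k *ᵥ φs - ψ))
          + (star φs ⬝ᵥ (nOp a c U k Ω *ᵥ φs) - (a : ℂ) * (star (qMatT U k *ᵥ φs) ⬝ᵥ (qMatT U k *ᵥ φs))))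
        + star δ ⬝ᵥ (nOp a c U k Ω *ᵥ δ) := by
    simp only [mulVec_add, star_add, star_sub, add_dotProduct, sub_dotProduct, dotProduct_add, dotProduct_sub]
    rw [hcross, hcross']
    ring
  -- conclude
  have hδN := form_nOp a c U k Ω δ
  have hE : ((a * ∑ y, ‖(qMatT U k *ᵥ φ - ψ) y‖ ^ 2 + ∑ b ∈ starB Ω, ‖covD c (cfg U) φ b‖ ^ 2 : ℝ) : ℂ)
      = star ψ ⬝ᵥ (deltaRegion a c U k Ω *ᵥ ψ)
        + ((∑ b ∈ starB Ω, ‖covD c (cfg U) δ b‖ ^ 2 + a * ∑ y, ‖(qMatK U k Ω *ᵥ δ) y‖ ^ 2 : ℝ) : ℂ) := by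
    rw [← hreal φ hφ, form_deltaRegion_eq_energy hk hc ha U hΩ ψ hφs, ← hreal φs hsupp, ← hδN]
    conv_lhs => rw [hφδ]
    exact key
  have hre := congrArg Complex.re hE
  rw [Complex.ofReal_re, Complex.add_re, Complex.ofReal_re] at hre
  rw [hre]
  have h0 : 0 ≤ ∑ b ∈ starB Ω, ‖covD c (cfg U) δ b‖ ^ 2 + a * ∑ y, ‖(qMatK U k Ω *ᵥ δ) y‖ ^ 2 :=
    add_nonneg (sum_nonneg fun _ _ => by positivity) (mul_nonneg ha.le (sum_nonneg fun _ _ => by positivity))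
  linarith

/-- **`⟨ψ, Δ_k(Ω,u)ψ⟩ ≤ a_k‖ψ‖²`** for every `U(1)` field `u`, every `k`-block union `Ω` (the variational inequality at `φ = 0`); with
`form_deltaRegion_re_nonneg`: `0 ≤ Δ_k(Ω,u) ≤ a_k` as forms (p11's `BIJ85BlockAveragingIneq.inner_deltaOp_le` is the case `Ω = T`).
[cite: BalabanImbrieJaffe1985, §4.6 (4.6.4) p.313] -/
theorem form_deltaRegion_re_le (hk : j + k ≤ P.m + P.K) (hc : c ≠ 0) (ha : 0 < a) (U : GaugeField P j U1)
    (hΩ : IsBlockUnion k Ω) (ψ : Balaban1983to89.Site P (j+k) → ℂ) :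
    (star ψ ⬝ᵥ (deltaRegion a c U k Ω *ᵥ ψ)).re ≤ a * ∑ y, ‖ψ y‖ ^ 2 := by
  have h := form_deltaRegion_le_energy hk hc ha U hΩ ψ (φ := 0) (fun _ _ => rfl)
  have hz : ∑ b ∈ starB Ω, ‖covD c (cfg U) (0 : Balaban1983to89.Site P j → ℂ) b‖ ^ 2 = 0 :=
    sum_eq_zero fun b _ => by rw [covD, Pi.zero_apply, Pi.zero_apply, mul_zero, sub_zero, mul_zero, norm_zero, zero_pow two_ne_zero]
  rw [hz, add_zero, mulVec_zero] at h
  simpa only [zero_sub, Pi.neg_apply, norm_neg, Pi.zero_apply] using h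

end Variational

end

end Literature.MathematicalPhysics.QuantumFieldTheory.BalabanImbrieJaffe1984to88.BIJ85Ineq732FlatRegion
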